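import Literature.Topology.FourManifolds.NonSeparatingSpheresCoverSeparation
import Literature.Topology.FourManifolds.CylinderToSphereEmbedding
import Literature.Topology.FourManifolds.InteriorDiscs
import HarnessLib

/-!
# Budney–Gabai Thm. 3.13: the sides of the lifted sphere and of its deck translate in `Sⁿ⁺¹`

Fact seat of `Literature.Topology.FourManifolds.BudneyGabai2019_thm_3_13`
(`NonSeparatingSpheres.lean`; R. Budney, D. Gabai, *Knotted 3-balls in `S⁴`*, arXiv:1912.09029,
Thm. 3.13).  For the classical cases `n ≤ 2` the lift `K̃ = ẽ(Sⁿ)` of a non-separating sphere and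
its deck translate `τ K̃` are read inside `Sⁿ⁺¹ ⊃ ι(ℝ × Sⁿ)` (`ι = CylinderToSphere.map n`) as two
disjoint smooth hypersurface spheres `Z₁ = ι(K̃)`, `Z₂ = ι(τ K̃)`, to be straightened by
Schoenflies balls and the disc theorem (`NonSeparatingSpheresStraightening.lean`).  This file
assembles the topology of their sides (`SphereHypersurfaceSides.IsSidePackage`):

* `exists_isSidePackage_normalised` — each of `Z₁`, `Z₂` has a side function `g` with
  **`g S < 0 < g N`** (the poles lie on opposite sides: `false_of_sublevel_bdd`,
  `NonSeparatingSpheresCoverSeparation.lean`), and then `g ∘ ι < 0` towards `-∞`, `> 0` towards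
  `+∞` (`exists_ends_of_isSidePackage`);
* `image_closedBall_eq_of_isSidePackage` — **a Schoenflies ball fills a side**: if
  `e : ℝᵐ⁺¹ → Sᵐ⁺¹` is a smooth embedding with `e(∂𝔻) = Z` and `p ∉ e(𝔻)` for a point with
  `g p > 0`, then `e(𝔻) = {g ≤ 0}` and `e(B̊) = {g < 0}` (the open ball image is open, connected
  and relatively closed in `Zᶜ`, hence a whole side; not the side of `p`);
* `neg_of_isSidePackage_translate` — **`K̃` lies below `τ K̃`**: `g₂ (ι (ẽ y)) < 0` for the
  normalised side function `g₂` of `Z₂` (constant sign on the connected `Sⁿ`; at the point of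
  `K̃` of least height the downward vertical ray misses `τ K̃` and reaches the region `g₂ ∘ ι < 0`);
  hence `{0 ≤ g₂} ⊆ {0 < g₁}` and `{g₁ ≤ 0} ⊆ {g₂ < 0}` (`nonneg_translate_subset_pos`,
  `nonpos_subset_neg_translate`);
* `neg_translate_iff_neg` — **`τ` carries the lower side of `K̃` onto the lower side of `τ K̃`**:
  `g₂ (ι (τ q)) < 0 ↔ g₁ (ι q) < 0` (both sets are relatively clopen in the complement of `K̃` and
  contain the `-∞` end; a point in one but not the other would have a *bounded* complementary
  component, excluded by `not_bdd_connectedComponentIn_compl_range_lift`), and the same for the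
  zero sets and upper sides; `exists_int_neg`, `exists_int_nonneg` — every deck orbit reaches
  both sides.

Everything here is proved; no definition and no named fact is introduced.

## References

* R. Budney, D. Gabai, *Knotted 3-balls in `S⁴`*, arXiv:1912.09029 (v2), §3, Thm. 3.13.
  [BudneyGabai2019]
* M. W. Hirsch, *Differential Topology*, GTM 33 (1976), Ch. 4 §4 (two-sidedness of
  hypersurfaces). [HirschDT1976]
-/

noncomputable section

open scoped Manifold ContDiff Topology Real RealInnerProductSpace
open Set Function Metric

namespace Literature.Topology.FourManifolds

namespace BudneyGabai2019_thm_3_13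

open CylinderToSphere SphereHypersurfaceSides

variable {n : ℕ}

local notation "𝔼 " k:arg => EuclideanSpace ℝ (Fin k)
local notation "𝕊 " k:arg => (Metric.sphere (0 : EuclideanSpace ℝ (Fin (k + 1))) 1)

/-! ### Ends of the cylinder versus poles -/

/-- If `g` is continuous with `0 < g N` then `g ∘ ι > 0` towards `+∞`; if `g S < 0` then
`g ∘ ι < 0` towards `-∞`. [folklore] -/
theorem exists_ends_of_sign_poles {g : 𝕊 (n + 1) → ℝ} (hg : Continuous g)
    (hN : 0 < g (northPole n)) (hS : g (southPole n) < 0) :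
    ∃ T : ℝ, 0 < T ∧ (∀ q : ℝ × 𝕊 n, T ≤ q.1 → 0 < g (map n q)) ∧
      ∀ q : ℝ × 𝕊 n, q.1 ≤ -T → g (map n q) < 0 := by
  obtain ⟨ε₁, hε₁, h₁⟩ := Metric.isOpen_iff.1 (isOpen_lt continuous_const hg) _ hN
  obtain ⟨ε₂, hε₂, h₂⟩ := Metric.isOpen_iff.1 (isOpen_lt hg continuous_const) _ hS
  obtain ⟨T₁, hT₁⟩ := dist_map_northPole_lt n hε₁
  obtain ⟨T₂, hT₂⟩ := dist_map_southPole_lt n hε₂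
  refine ⟨max (max T₁ (-T₂)) 1, by positivity, fun q hq ↦ h₁ (hT₁ q ?_), fun q hq ↦ h₂ (hT₂ q ?_)⟩
  · exact le_trans (le_trans (le_max_left _ _) (le_max_left _ _)) hq
  · have : -max (max T₁ (-T₂)) 1 ≤ T₂ := by
      have := le_trans (le_max_right T₁ (-T₂)) (le_max_left _ (1 : ℝ))
      linarith
    exact hq.trans this

/-! ### Normalised side packages of the lifted sphere -/

/-- **The poles lie on opposite sides of the lift of a non-separating sphere.**  For a smooth
embedding `e : Sⁿ → S¹ × Sⁿ` (`n ≥ 1`) with connected complement, a smoothly embedded lift `ẽ`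
(`(exp × id) ∘ ẽ = e`) and any side package `g` of `ι(ẽ(Sⁿ)) ⊆ Sⁿ⁺¹`: `g N · g S < 0`.
Otherwise the side of `g` opposite to both poles would be a nonempty bounded (in `t`) strict
sublevel of the continuous function `g ∘ ι`, which vanishes exactly on `ẽ(Sⁿ)` — impossible by
`false_of_sublevel_bdd`. [cite: BudneyGabai2019, proof of Thm. 3.13] -/
theorem sidePackage_poles_mul_neg (hn : 1 ≤ n)
    {e : 𝕊 n → Circle × 𝕊 n} (he : Manifold.IsSmoothEmbedding (𝓡 n) ((𝓡 1).prod (𝓡 n)) ∞ e)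
    (hconn : IsConnected (range e)ᶜ)
    {el : 𝕊 n → ℝ × 𝕊 n} (hel : Manifold.IsSmoothEmbedding (𝓡 n) (𝓘(ℝ, ℝ).prod (𝓡 n)) ∞ el)
    (hlift : Prod.map Circle.exp id ∘ el = e)
    {g : 𝕊 (n + 1) → ℝ} (hg : IsSidePackage (range (map n ∘ el)) g) :
    g (northPole n) * g (southPole n) < 0 := by
  have hgc : Continuous g := hg.isRegularLevel.contMDiff.continuous
  have hg0 : ∀ z, g z = 0 ↔ z ∈ range (map n ∘ el) := fun z ↦ by
    rw [← hg.preimage_zero]; rfl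
  have hGN : g (northPole n) ≠ 0 := fun h0 ↦ by
    obtain ⟨x, hx⟩ := (hg0 _).1 h0
    exact map_ne_northPole n (el x) hx
  have hGS : g (southPole n) ≠ 0 := fun h0 ↦ by
    obtain ⟨x, hx⟩ := (hg0 _).1 h0
    exact map_ne_southPole n (el x) hx
  by_contra hnot
  have hpos : 0 < g (northPole n) * g (southPole n) :=
    lt_of_le_of_ne (not_lt.1 hnot) (mul_ne_zero hGN hGS).symm
  set σ : ℝ := g (northPole n) with hσ
  -- the side `{σ g < 0}` misses both poles
  have hσN : 0 < σ * g (northPole n) := mul_self_pos.2 hGN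
  have hσS : 0 < σ * g (southPole n) := hpos
  -- the continuous function `G = g ∘ ι` on the cylinder
  set G : ℝ × 𝕊 n → ℝ := g ∘ map n with hG
  have hGc : Continuous G := hgc.comp (continuous_map n)
  have hG0 : ∀ q, G q = 0 ↔ q ∈ range el := fun q ↦ by
    rw [hG, comp_apply, hg0, range_comp]
    exact (injective_map n).mem_set_image
  -- boundedness of `{σ G ≤ 0}`: the compact set `{σ g ≤ 0}` misses the poles
  have hbdd : ∃ T : ℝ, ∀ q, σ * G q ≤ 0 → |q.1| ≤ T := by
    set Zs : Set (𝕊 (n + 1)) := {z | σ * g z ≤ 0} with hZs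
    have hZc : IsCompact Zs := (isClosed_le (continuous_const.mul hgc) continuous_const).isCompact
    obtain ⟨ε₁, hε₁, hfar₁⟩ : ∃ ε > 0, ∀ z ∈ Zs, ε ≤ dist z (northPole n) := by
      by_cases hZe : Zs.Nonempty
      · obtain ⟨z₀, hz₀, hmin⟩ :=
          hZc.exists_isMinOn hZe (continuous_id.dist continuous_const).continuousOn
        refine ⟨dist z₀ (northPole n), dist_pos.2 (fun h ↦ ?_), fun z hz ↦ hmin hz⟩
        rw [h] at hz₀
        exact (not_le.2 hσN) hz₀
      · exact ⟨1, one_pos, fun z hz ↦ (hZe ⟨z, hz⟩).elim⟩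
    obtain ⟨ε₂, hε₂, hfar₂⟩ : ∃ ε > 0, ∀ z ∈ Zs, ε ≤ dist z (southPole n) := by
      by_cases hZe : Zs.Nonempty
      · obtain ⟨z₀, hz₀, hmin⟩ :=
          hZc.exists_isMinOn hZe (continuous_id.dist continuous_const).continuousOn
        refine ⟨dist z₀ (southPole n), dist_pos.2 (fun h ↦ ?_), fun z hz ↦ hmin hz⟩
        rw [h] at hz₀
        exact (not_le.2 hσS) hz₀
      · exact ⟨1, one_pos, fun z hz ↦ (hZe ⟨z, hz⟩).elim⟩
    obtain ⟨T₁, hT₁⟩ := dist_map_northPole_lt n hε₁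
    obtain ⟨T₂, hT₂⟩ := dist_map_southPole_lt n hε₂
    refine ⟨max |T₁| |T₂|, fun q hq ↦ ?_⟩
    have hqZ : map n q ∈ Zs := hq
    rw [abs_le]
    constructor
    · by_contra hlt
      push Not at hlt
      have h1 : q.1 ≤ T₂ := by
        have : -max |T₁| |T₂| ≤ -|T₂| := neg_le_neg (le_max_right _ _)
        linarith [neg_abs_le T₂]
      exact absurd (hfar₂ _ hqZ) (not_le.2 (hT₂ q h1))
    · by_contra hlt
      push Not at hlt
      have h1 : T₁ ≤ q.1 := by
        have : |T₁| ≤ max |T₁| |T₂| := le_max_left _ _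
        linarith [le_abs_self T₁]
      exact absurd (hfar₁ _ hqZ) (not_le.2 (hT₁ q h1))
  -- a point with `σ G < 0`: the side of `g` of sign `-σ` is nonempty and pole-free
  obtain ⟨q₀, hq₀⟩ : ∃ q₀, σ * G q₀ < 0 := by
    have hside : ({z : 𝕊 (n + 1) | σ * g z < 0}).Nonempty := by
      rcases lt_or_gt_of_ne hGN with hlt | hlt
      · obtain ⟨z, hz⟩ := hg.isConnected_pos.nonempty
        exact ⟨z, by rw [hσ]; exact mul_neg_of_neg_of_pos hlt hz⟩
      · obtain ⟨z, hz⟩ := hg.isConnected_neg.nonempty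
        exact ⟨z, by rw [hσ]; exact mul_neg_of_pos_of_neg hlt hz⟩
    obtain ⟨z, hz⟩ := hside
    have hzr : z ∈ range (map n) := by
      rw [range_map]
      simp only [mem_compl_iff, mem_insert_iff, mem_singleton_iff, not_or]
      constructor
      · rintro rfl; exact (not_lt.2 hσN.le) hz
      · rintro rfl; exact (not_lt.2 hσS.le) hz
    obtain ⟨q₀, rfl⟩ := hzr
    exact ⟨q₀, hz⟩
  exact false_of_sublevel_bdd hn he hconn hel.contMDiff.continuous hlift hGc hG0 hbdd hq₀

/-- **A normalised side package**: the lift `ι(ẽ(Sⁿ))` of a non-separating sphere has a side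
function with `g S < 0 < g N` (take any side package and change its sign if necessary,
`IsSidePackage.neg`, `sidePackage_poles_mul_neg`). [folklore] -/
theorem exists_isSidePackage_normalised (hn : 1 ≤ n)
    {e : 𝕊 n → Circle × 𝕊 n} (he : Manifold.IsSmoothEmbedding (𝓡 n) ((𝓡 1).prod (𝓡 n)) ∞ e)
    (hconn : IsConnected (range e)ᶜ)
    {el : 𝕊 n → ℝ × 𝕊 n} (hel : Manifold.IsSmoothEmbedding (𝓡 n) (𝓘(ℝ, ℝ).prod (𝓡 n)) ∞ el)
    (hlift : Prod.map Circle.exp id ∘ el = e) :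
    ∃ g : 𝕊 (n + 1) → ℝ, IsSidePackage (range (map n ∘ el)) g ∧
      g (southPole n) < 0 ∧ 0 < g (northPole n) := by
  obtain ⟨g, hg⟩ := exists_isSidePackage hn (isSmoothEmbedding_map_comp n hel)
  have hmul := sidePackage_poles_mul_neg hn he hconn hel hlift hg
  have hN0 : g (northPole n) ≠ 0 := fun h ↦ by
    rw [h, zero_mul] at hmul
    exact lt_irrefl _ hmul
  rcases lt_or_gt_of_ne hN0 with hlt | hlt
  · refine ⟨fun z ↦ -g z, hg.neg, ?_, by linarith⟩
    have : 0 < g (southPole n) := by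
      by_contra h; push Not at h; nlinarith
    linarith
  · refine ⟨g, hg, ?_, hlt⟩
    by_contra h; push Not at h; nlinarith

/-! ### A Schoenflies ball fills a side -/

section BallSide

variable {m : ℕ}

/-- **A Schoenflies ball fills a side.**  Let `g` be a side package of `Z ⊆ Sᵐ⁺¹` and
`e : ℝᵐ⁺¹ → Sᵐ⁺¹` a smooth embedding with `e(∂𝔻) = Z`.  If some point `p` with `0 < g p` is not
in `e(𝔻)`, then `e(B̊) = {g < 0}` and `e(𝔻) = {g ≤ 0}`: the open-ball image is open
(`isOpenMap_disc`), connected, disjoint from `Z` and relatively closed in `Zᶜ` (its closure lies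
in the compact `e(𝔻) = e(B̊) ∪ Z`), hence equal to one whole side; not the side of `p`.
[folklore] -/
theorem image_ball_eq_of_isSidePackage {Z : Set (𝕊 (m + 1))} {g : 𝕊 (m + 1) → ℝ}
    (hg : IsSidePackage Z g) {e : 𝔼 (m + 1) → 𝕊 (m + 1)}
    (he : Manifold.IsSmoothEmbedding 𝓘(ℝ, 𝔼 (m + 1)) (𝓡 (m + 1)) ∞ e)
    (hZ : e '' sphere 0 1 = Z) {p : 𝕊 (m + 1)} (hp : 0 < g p) (hpe : p ∉ e '' closedBall 0 1) :
    e '' ball 0 1 = {z | g z < 0} := by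
  have hgc : Continuous g := hg.isRegularLevel.contMDiff.continuous
  have hg0 : ∀ z, g z = 0 ↔ z ∈ Z := fun z ↦ by rw [← hg.preimage_zero]; rfl
  have hinj : Injective e := he.isEmbedding.injective
  have hec : Continuous e := he.contMDiff.continuous
  set B : Set (𝕊 (m + 1)) := e '' ball 0 1 with hB
  have hBo : IsOpen B := isOpenMap_disc he _ isOpen_ball
  have hBc : IsConnected B :=
    ((convex_ball (0 : 𝔼 (m + 1)) 1).isConnected (nonempty_ball.2 one_pos)).image e hec.continuousOn
  have hBne : B.Nonempty := hBc.nonempty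
  have hBZ : Disjoint B Z := by
    rw [← hZ, hB]
    refine (disjoint_image_iff hinj).2 (disjoint_left.2 fun x hx hx' ↦ ?_)
    rw [mem_ball_zero_iff] at hx
    rw [mem_sphere_zero_iff_norm] at hx'
    linarith
  have hcover : B ⊆ {z | g z < 0} ∪ {z | 0 < g z} := fun z hz ↦ by
    have hz0 : g z ≠ 0 := fun h ↦ hBZ.ne_of_mem hz ((hg0 z).1 h) rfl
    rcases lt_or_gt_of_ne hz0 with h | h
    · exact Or.inl h
    · exact Or.inr h
  -- `closure B ⊆ B ∪ Z`
  have hcl : closure B ⊆ B ∪ Z := by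
    have h1 : closure B ⊆ e '' closedBall 0 1 :=
      closure_minimal (image_mono ball_subset_closedBall)
        ((isCompact_closedBall (0 : 𝔼 (m + 1)) 1).image hec).isClosed
    intro z hz
    obtain ⟨x, hx, rfl⟩ := h1 hz
    rw [mem_closedBall_zero_iff] at hx
    rcases hx.lt_or_eq with h | h
    · exact Or.inl ⟨x, mem_ball_zero_iff.2 h, rfl⟩
    · right
      rw [← hZ]
      exact ⟨x, mem_sphere_zero_iff_norm.2 h, rfl⟩
  -- a side contained in... containing `B` is contained in `B`
  have hfill : ∀ {A : Set (𝕊 (m + 1))}, IsPreconnected A → Disjoint A Z → B ⊆ A → A ⊆ B := by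
    intro A hA hAZ hBA
    refine hA.subset_left_of_subset_union (u := B) (v := (closure B)ᶜ) hBo
      isClosed_closure.isOpen_compl
      (disjoint_compl_right.mono_right (compl_subset_compl.2 subset_closure)) (fun z hz ↦ ?_)
      (by obtain ⟨z, hz⟩ := hBne; exact ⟨z, hBA hz, hz⟩)
    by_cases hzc : z ∈ closure B
    · rcases hcl hzc with h | h
      · exact Or.inl h
      · exact (hAZ.ne_of_mem hz h rfl).elim
    · exact Or.inr hzc
  rcases hBc.isPreconnected.subset_or_subset (isOpen_lt hgc continuous_const)
    (isOpen_lt continuous_const hgc) (disjoint_left.2 fun z (h1 : g z < 0) (h2 : 0 < g z) ↦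
      lt_asymm h1 h2) hcover with hneg | hposB
  · refine Subset.antisymm hneg (hfill hg.isConnected_neg.isPreconnected
      (disjoint_left.2 fun z (hz : g z < 0) hzZ ↦ (ne_of_lt hz) ((hg0 z).2 hzZ)) hneg)
  · exfalso
    have hsub : {z | 0 < g z} ⊆ B := hfill hg.isConnected_pos.isPreconnected
      (disjoint_left.2 fun z (hz : 0 < g z) hzZ ↦ (ne_of_gt hz) ((hg0 z).2 hzZ)) hposB
    exact hpe (image_mono ball_subset_closedBall (hsub hp))

/-- Under the same hypotheses, `e(𝔻) = {g ≤ 0}`. [folklore] -/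
theorem image_closedBall_eq_of_isSidePackage {Z : Set (𝕊 (m + 1))} {g : 𝕊 (m + 1) → ℝ}
    (hg : IsSidePackage Z g) {e : 𝔼 (m + 1) → 𝕊 (m + 1)}
    (he : Manifold.IsSmoothEmbedding 𝓘(ℝ, 𝔼 (m + 1)) (𝓡 (m + 1)) ∞ e)
    (hZ : e '' sphere 0 1 = Z) {p : 𝕊 (m + 1)} (hp : 0 < g p) (hpe : p ∉ e '' closedBall 0 1) :
    e '' closedBall 0 1 = {z | g z ≤ 0} := by
  have hg0 : ∀ z, g z = 0 ↔ z ∈ Z := fun z ↦ by rw [← hg.preimage_zero]; rfl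
  rw [← ball_union_sphere, image_union, image_ball_eq_of_isSidePackage hg he hZ hp hpe, hZ]
  ext z
  simp only [mem_union, mem_setOf_eq, ← hg0]
  constructor
  · rintro (h | h)
    · exact h.le
    · exact h.le
  · intro h
    rcases h.lt_or_eq with h1 | h1
    · exact Or.inl h1
    · exact Or.inr h1

/-- Mirror image: if the missing point has `g p < 0` then `e(B̊) = {0 < g}` and
`e(𝔻) = {0 ≤ g}`. [folklore] -/
theorem image_closedBall_eq_of_isSidePackage' {Z : Set (𝕊 (m + 1))} {g : 𝕊 (m + 1) → ℝ}
    (hg : IsSidePackage Z g) {e : 𝔼 (m + 1) → 𝕊 (m + 1)}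
    (he : Manifold.IsSmoothEmbedding 𝓘(ℝ, 𝔼 (m + 1)) (𝓡 (m + 1)) ∞ e)
    (hZ : e '' sphere 0 1 = Z) {p : 𝕊 (m + 1)} (hp : g p < 0) (hpe : p ∉ e '' closedBall 0 1) :
    e '' ball 0 1 = {z | 0 < g z} ∧ e '' closedBall 0 1 = {z | 0 ≤ g z} := by
  have h1 := image_ball_eq_of_isSidePackage hg.neg he hZ (by simpa using hp) hpe
  have h2 := image_closedBall_eq_of_isSidePackage hg.neg he hZ (by simpa using hp) hpe
  simp only [neg_lt_zero, neg_nonpos] at h1 h2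
  exact ⟨h1, h2⟩

end BallSide

/-! ### `K̃` lies below `τ K̃`; nesting of the sides -/

/-- `Sⁿ` is connected for `n ≥ 1`. [folklore] -/
theorem isConnected_univ_sphere (hn : 1 ≤ n) : IsConnected (univ : Set (𝕊 n)) := by
  have hr : 1 < Module.rank ℝ (𝔼 (n + 1)) :=
    Module.lt_rank_of_lt_finrank (by rw [finrank_euclideanSpace_fin]; omega)
  haveI := isConnected_iff_connectedSpace.1
    (isConnected_sphere hr (0 : 𝔼 (n + 1)) zero_le_one)
  exact isConnected_univ

/-- **The lifted sphere lies on the lower side of its deck translate**: for the normalised side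
function `g₂` (`g₂ S < 0 < g₂ N`) of `Z₂ = ι(τ ẽ(Sⁿ))`, `τ (t, y) = (t + 2π, y)`, one has
`g₂ (ι (ẽ y)) < 0` for all `y`.  The sign is constant on the connected `Sⁿ` (`ι(ẽ(Sⁿ))` misses
`Z₂`, the deck translates being disjoint); at a point of `ẽ(Sⁿ)` of least height `t*` the
vertical ray `s ≤ t*` misses `τ ẽ(Sⁿ)` (whose heights are `≥ t* + 2π`) and reaches the region
where `g₂ ∘ ι < 0`. [cite: BudneyGabai2019, proof of Thm. 3.13] -/
theorem neg_of_isSidePackage_translate (hn : 1 ≤ n)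
    {e : 𝕊 n → Circle × 𝕊 n} (he : Manifold.IsSmoothEmbedding (𝓡 n) ((𝓡 1).prod (𝓡 n)) ∞ e)
    {el : 𝕊 n → ℝ × 𝕊 n} (hel : Manifold.IsSmoothEmbedding (𝓡 n) (𝓘(ℝ, ℝ).prod (𝓡 n)) ∞ el)
    (hlift : Prod.map Circle.exp id ∘ el = e)
    {g₂ : 𝕊 (n + 1) → ℝ}
    (hg₂ : IsSidePackage (range (map n ∘ (fun q : ℝ × 𝕊 n ↦ ((q.1 + 2 * π, q.2) : ℝ × 𝕊 n)) ∘ el))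
      g₂)
    (hS : g₂ (southPole n) < 0) (hN : 0 < g₂ (northPole n)) (y : 𝕊 n) :
    g₂ (map n (el y)) < 0 := by
  have hgc : Continuous g₂ := hg₂.isRegularLevel.contMDiff.continuous
  have helc : Continuous el := hel.contMDiff.continuous
  have hg0 : ∀ z, g₂ z = 0 ↔
      z ∈ range (map n ∘ (fun q : ℝ × 𝕊 n ↦ ((q.1 + 2 * π, q.2) : ℝ × 𝕊 n)) ∘ el) := fun z ↦ by
    rw [← hg₂.preimage_zero]; rfl
  obtain ⟨T, hT, hTpos, hTneg⟩ := exists_ends_of_sign_poles hgc hN hS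
  -- the sign of `g₂ ∘ ι ∘ ẽ` is constant
  set φ : 𝕊 n → ℝ := fun y ↦ g₂ (map n (el y)) with hφ
  have hφc : Continuous φ := hgc.comp ((continuous_map n).comp helc)
  have hφ0 : ∀ y, φ y ≠ 0 := by
    intro y h0
    obtain ⟨x, hx⟩ := (hg0 _).1 h0
    simp only [comp_apply] at hx
    have hx' := injective_map n hx
    have hdisj := disjoint_range_lift_deck he.isEmbedding.injective hlift (m := 1) one_ne_zero
    refine hdisj.ne_of_mem (mem_range_self y) ⟨el x, mem_range_self x, ?_⟩ rfl
    rw [← hx']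
    simp
  -- a point of least height
  obtain ⟨y₀, -, hy₀⟩ := isCompact_univ.exists_isMinOn univ_nonempty
    ((continuous_fst.comp helc).continuousOn : ContinuousOn (fun y : 𝕊 n ↦ (el y).1) univ)
  have hmin : ∀ y, (el y₀).1 ≤ (el y).1 := fun y ↦ hy₀ (mem_univ y)
  -- along the vertical ray below `ẽ y₀`, `g₂ ∘ ι` does not vanish
  set w := (el y₀).2 with hw
  set t₀ := (el y₀).1 with ht₀
  have hray : ∀ s, s ≤ t₀ → g₂ (map n (s, w)) ≠ 0 := by
    intro s hs h0
    obtain ⟨x, hx⟩ := (hg0 _).1 h0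
    simp only [comp_apply] at hx
    have hx' := injective_map n hx
    have h1 : (el x).1 + 2 * π = s := congrArg Prod.fst hx'
    have h2 := hmin x
    linarith [Real.pi_pos]
  have hrayneg : g₂ (map n (t₀, w)) < 0 := by
    -- constant sign on the connected ray `Iic t₀`, negative far down
    have hcont : Continuous fun s : ℝ ↦ g₂ (map n (s, w)) :=
      hgc.comp ((continuous_map n).comp (continuous_id.prodMk continuous_const))
    have hpre : IsPreconnected (Iic t₀) := isPreconnected_Iic
    rcases hpre.subset_or_subset ((isOpen_lt hcont continuous_const).preimage continuous_id :
        IsOpen {s : ℝ | g₂ (map n (s, w)) < 0})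
      (isOpen_lt continuous_const hcont : IsOpen {s : ℝ | 0 < g₂ (map n (s, w))})
      (disjoint_left.2 fun s (h1 : g₂ (map n (s, w)) < 0) (h2 : 0 < g₂ (map n (s, w))) ↦
        lt_asymm h1 h2)
      (fun s hs ↦ (lt_or_gt_of_ne (hray s hs)).imp id id) with h | h
    · exact h (mem_Iic.2 le_rfl)
    · exfalso
      have h1 : min t₀ (-T) ∈ Iic t₀ := mem_Iic.2 (min_le_left _ _)
      have h2 : 0 < g₂ (map n (min t₀ (-T), w)) := h h1
      have h3 := hTneg (min t₀ (-T), w) (min_le_right _ _)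
      exact lt_asymm h2 h3
  have hφy₀ : φ y₀ < 0 := by
    simp only [hφ, ht₀, hw, Prod.mk.eta] at hrayneg ⊢
    exact hrayneg
  -- constant sign on `Sⁿ`
  rcases (isConnected_univ_sphere hn).isPreconnected.subset_or_subset
      (isOpen_lt hφc continuous_const : IsOpen {y : 𝕊 n | φ y < 0})
      (isOpen_lt continuous_const hφc : IsOpen {y : 𝕊 n | 0 < φ y})
      (disjoint_left.2 fun y (h1 : φ y < 0) (h2 : 0 < φ y) ↦ lt_asymm h1 h2)
      (fun y _ ↦ (lt_or_gt_of_ne (hφ0 y)).imp id id) with h | h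
  · exact h (mem_univ y)
  · exact (lt_asymm (h (mem_univ y₀)) hφy₀).elim

/-- **Nesting of the sides**: `{0 ≤ g₂} ⊆ {0 < g₁}` for the normalised side functions of
`Z₁ = ι(ẽ(Sⁿ))` and `Z₂ = ι(τ ẽ(Sⁿ))` — the closed upper side of the translate is connected,
misses `Z₁` (`neg_of_isSidePackage_translate`) and contains `N`. [folklore] -/
theorem nonneg_translate_subset_pos (hn : 1 ≤ n)
    {e : 𝕊 n → Circle × 𝕊 n} (he : Manifold.IsSmoothEmbedding (𝓡 n) ((𝓡 1).prod (𝓡 n)) ∞ e)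
    {el : 𝕊 n → ℝ × 𝕊 n} (hel : Manifold.IsSmoothEmbedding (𝓡 n) (𝓘(ℝ, ℝ).prod (𝓡 n)) ∞ el)
    (hlift : Prod.map Circle.exp id ∘ el = e)
    {g₁ : 𝕊 (n + 1) → ℝ} (hg₁ : IsSidePackage (range (map n ∘ el)) g₁)
    (hN₁ : 0 < g₁ (northPole n))
    {g₂ : 𝕊 (n + 1) → ℝ}
    (hg₂ : IsSidePackage (range (map n ∘ (fun q : ℝ × 𝕊 n ↦ ((q.1 + 2 * π, q.2) : ℝ × 𝕊 n)) ∘ el))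
      g₂)
    (hS₂ : g₂ (southPole n) < 0) (hN₂ : 0 < g₂ (northPole n)) :
    {z | 0 ≤ g₂ z} ⊆ {z | 0 < g₁ z} := by
  have hgc : Continuous g₁ := hg₁.isRegularLevel.contMDiff.continuous
  have hg0 : ∀ z, g₁ z = 0 ↔ z ∈ range (map n ∘ el) := fun z ↦ by
    rw [← hg₁.preimage_zero]; rfl
  have hconn : IsPreconnected {z | 0 ≤ g₂ z} := by
    rw [← hg₂.closure_pos]
    exact hg₂.isConnected_pos.isPreconnected.closure
  have hcover : {z | 0 ≤ g₂ z} ⊆ {z | g₁ z < 0} ∪ {z | 0 < g₁ z} := by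
    intro z hz
    have hz0 : g₁ z ≠ 0 := by
      intro h0
      obtain ⟨y, rfl⟩ := (hg0 z).1 h0
      have := neg_of_isSidePackage_translate hn he hel hlift hg₂ hS₂ hN₂ y
      exact (not_le.2 this) hz
    rcases lt_or_gt_of_ne hz0 with h | h
    · exact Or.inl h
    · exact Or.inr h
  rcases hconn.subset_or_subset (isOpen_lt hgc continuous_const) (isOpen_lt continuous_const hgc)
    (disjoint_left.2 fun z (h1 : g₁ z < 0) (h2 : 0 < g₁ z) ↦ lt_asymm h1 h2) hcover with h | h
  · exact (lt_asymm (h (show 0 ≤ g₂ (northPole n) from hN₂.le)) hN₁).elim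
  · exact h

/-- Consequently `{g₁ ≤ 0} ⊆ {g₂ < 0}`: the closed lower side of `Z₁` lies in the open lower
side of `Z₂`. [folklore] -/
theorem nonpos_subset_neg_translate (hn : 1 ≤ n)
    {e : 𝕊 n → Circle × 𝕊 n} (he : Manifold.IsSmoothEmbedding (𝓡 n) ((𝓡 1).prod (𝓡 n)) ∞ e)
    {el : 𝕊 n → ℝ × 𝕊 n} (hel : Manifold.IsSmoothEmbedding (𝓡 n) (𝓘(ℝ, ℝ).prod (𝓡 n)) ∞ el)
    (hlift : Prod.map Circle.exp id ∘ el = e)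
    {g₁ : 𝕊 (n + 1) → ℝ} (hg₁ : IsSidePackage (range (map n ∘ el)) g₁)
    (hN₁ : 0 < g₁ (northPole n))
    {g₂ : 𝕊 (n + 1) → ℝ}
    (hg₂ : IsSidePackage (range (map n ∘ (fun q : ℝ × 𝕊 n ↦ ((q.1 + 2 * π, q.2) : ℝ × 𝕊 n)) ∘ el))
      g₂)
    (hS₂ : g₂ (southPole n) < 0) (hN₂ : 0 < g₂ (northPole n)) :
    {z | g₁ z ≤ 0} ⊆ {z | g₂ z < 0} := by
  intro z hz
  by_contra h
  simp only [mem_setOf_eq, not_lt] at h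
  have := nonneg_translate_subset_pos hn he hel hlift hg₁ hN₁ hg₂ hS₂ hN₂ h
  exact (not_lt.2 hz) (show 0 < g₁ z from this)

/-! ### The deck transformation carries the sides of `K̃` onto the sides of `τ K̃` -/

/-- **`τ` carries the lower side of `K̃` onto the lower side of `τ K̃`.**  For the normalised
side functions `g₁` of `Z₁ = ι(ẽ(Sⁿ))` and `g₂` of `Z₂ = ι(τ ẽ(Sⁿ))`:
`g₂ (ι (τ q)) < 0 ↔ g₁ (ι q) < 0`.  Both sets are open, closed relative to the complement of
`ẽ(Sⁿ)` (their frontiers lie on the zero set `ẽ(Sⁿ)`), and contain the `-∞` end of the cylinder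
while missing the `+∞` end; a point in one and not in the other would have its whole
complementary component inside a slab `[a, b] × Sⁿ`, contradicting
`not_bdd_connectedComponentIn_compl_range_lift`. [cite: BudneyGabai2019, proof of Thm. 3.13] -/
theorem neg_translate_iff_neg (hn : 1 ≤ n)
    {e : 𝕊 n → Circle × 𝕊 n} (he : Manifold.IsSmoothEmbedding (𝓡 n) ((𝓡 1).prod (𝓡 n)) ∞ e)
    (hconn : IsConnected (range e)ᶜ)
    {el : 𝕊 n → ℝ × 𝕊 n} (hel : Manifold.IsSmoothEmbedding (𝓡 n) (𝓘(ℝ, ℝ).prod (𝓡 n)) ∞ el)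
    (hlift : Prod.map Circle.exp id ∘ el = e)
    {g₁ : 𝕊 (n + 1) → ℝ} (hg₁ : IsSidePackage (range (map n ∘ el)) g₁)
    (hS₁ : g₁ (southPole n) < 0) (hN₁ : 0 < g₁ (northPole n))
    {g₂ : 𝕊 (n + 1) → ℝ}
    (hg₂ : IsSidePackage (range (map n ∘ (fun q : ℝ × 𝕊 n ↦ ((q.1 + 2 * π, q.2) : ℝ × 𝕊 n)) ∘ el))
      g₂)
    (hS₂ : g₂ (southPole n) < 0) (hN₂ : 0 < g₂ (northPole n)) (q : ℝ × 𝕊 n) :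
    g₂ (map n (q.1 + 2 * π, q.2)) < 0 ↔ g₁ (map n q) < 0 := by
  have hgc₁ : Continuous g₁ := hg₁.isRegularLevel.contMDiff.continuous
  have hgc₂ : Continuous g₂ := hg₂.isRegularLevel.contMDiff.continuous
  have hg0₁ : ∀ r : ℝ × 𝕊 n, g₁ (map n r) = 0 ↔ r ∈ range el := fun r ↦ by
    have : g₁ (map n r) = 0 ↔ map n r ∈ range (map n ∘ el) := by rw [← hg₁.preimage_zero]; rfl
    rw [this, range_comp]
    exact (injective_map n).mem_set_image
  have hg0₂ : ∀ r : ℝ × 𝕊 n, g₂ (map n (r.1 + 2 * π, r.2)) = 0 ↔ r ∈ range el := fun r ↦ by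
    have : g₂ (map n (r.1 + 2 * π, r.2)) = 0 ↔ map n (r.1 + 2 * π, r.2) ∈
        range (map n ∘ (fun q : ℝ × 𝕊 n ↦ ((q.1 + 2 * π, q.2) : ℝ × 𝕊 n)) ∘ el) := by
      rw [← hg₂.preimage_zero]; rfl
    rw [this]
    constructor
    · rintro ⟨y, hy⟩
      simp only [comp_apply] at hy
      obtain ⟨h1a, h1b⟩ := Prod.mk.inj (injective_map n hy)
      exact ⟨y, Prod.ext (by linarith) h1b⟩
    · rintro ⟨y, rfl⟩
      exact ⟨y, rfl⟩
  obtain ⟨T₁, hT₁, hpos₁, hneg₁⟩ := exists_ends_of_sign_poles hgc₁ hN₁ hS₁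
  obtain ⟨T₂, hT₂, hpos₂, hneg₂⟩ := exists_ends_of_sign_poles hgc₂ hN₂ hS₂
  -- the four open sets on the cylinder
  have hcτ : Continuous fun r : ℝ × 𝕊 n ↦ ((r.1 + 2 * π, r.2) : ℝ × 𝕊 n) := by fun_prop
  have hoA : IsOpen {r : ℝ × 𝕊 n | g₁ (map n r) < 0} :=
    isOpen_lt (hgc₁.comp (continuous_map n)) continuous_const
  have hoB : IsOpen {r : ℝ × 𝕊 n | 0 < g₁ (map n r)} :=
    isOpen_lt continuous_const (hgc₁.comp (continuous_map n))
  have hoA' : IsOpen {r : ℝ × 𝕊 n | g₂ (map n (r.1 + 2 * π, r.2)) < 0} :=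
    isOpen_lt (hgc₂.comp ((continuous_map n).comp hcτ)) continuous_const
  have hoB' : IsOpen {r : ℝ × 𝕊 n | 0 < g₂ (map n (r.1 + 2 * π, r.2))} :=
    isOpen_lt continuous_const (hgc₂.comp ((continuous_map n).comp hcτ))
  -- a complementary component lies in each of the sets it meets
  have hcomp : ∀ {u v : Set (ℝ × 𝕊 n)}, IsOpen u → IsOpen v → Disjoint u v →
      (range el)ᶜ ⊆ u ∪ v → ∀ {x}, x ∈ u → x ∉ range el → connectedComponentIn (range el)ᶜ x ⊆ u :=
    fun {u v} hu hv huv hcov {x} hx hxK ↦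
      isPreconnected_connectedComponentIn.subset_left_of_subset_union hu hv huv
        ((connectedComponentIn_subset _ _).trans hcov) ⟨x, mem_connectedComponentIn hxK, hx⟩
  have hcov₁ : (range el)ᶜ ⊆ {r : ℝ × 𝕊 n | g₁ (map n r) < 0} ∪ {r | 0 < g₁ (map n r)} := by
    intro r hr
    rcases lt_or_gt_of_ne (fun h ↦ hr ((hg0₁ r).1 h)) with h | h
    · exact Or.inl h
    · exact Or.inr h
  have hcov₂ : (range el)ᶜ ⊆ {r : ℝ × 𝕊 n | g₂ (map n (r.1 + 2 * π, r.2)) < 0} ∪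
      {r | 0 < g₂ (map n (r.1 + 2 * π, r.2))} := by
    intro r hr
    rcases lt_or_gt_of_ne (fun h ↦ hr ((hg0₂ r).1 h)) with h | h
    · exact Or.inl h
    · exact Or.inr h
  have hd₁ : Disjoint {r : ℝ × 𝕊 n | g₁ (map n r) < 0} {r | 0 < g₁ (map n r)} :=
    disjoint_left.2 fun r (h1 : g₁ (map n r) < 0) (h2 : 0 < g₁ (map n r)) ↦ lt_asymm h1 h2
  have hd₂ : Disjoint {r : ℝ × 𝕊 n | g₂ (map n (r.1 + 2 * π, r.2)) < 0}
      {r | 0 < g₂ (map n (r.1 + 2 * π, r.2))} :=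
    disjoint_left.2 fun r (h1 : g₂ (map n (r.1 + 2 * π, r.2)) < 0)
      (h2 : 0 < g₂ (map n (r.1 + 2 * π, r.2))) ↦ lt_asymm h1 h2
  constructor
  · intro hq
    by_contra hq'
    have hqK : q ∉ range el := fun h ↦ (ne_of_lt hq) ((hg0₂ q).2 h)
    have hqB : 0 < g₁ (map n q) := (lt_or_gt_of_ne (fun h ↦ hqK ((hg0₁ q).1 h))).resolve_left hq'
    have h1 : connectedComponentIn (range el)ᶜ q ⊆ {r | g₂ (map n (r.1 + 2 * π, r.2)) < 0} :=
      hcomp hoA' hoB' hd₂ hcov₂ hq hqK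
    have h2 : connectedComponentIn (range el)ᶜ q ⊆ {r | 0 < g₁ (map n r)} :=
      hcomp hoB hoA hd₁.symm (union_comm _ _ ▸ hcov₁) hqB hqK
    refine not_bdd_connectedComponentIn_compl_range_lift hn he hconn hel.contMDiff.continuous hlift
      hqK (a := -T₁) (b := T₂) fun r hr ↦ ⟨⟨?_, ?_⟩, mem_univ _⟩
    · by_contra hlt; push Not at hlt
      exact lt_asymm (h2 hr) (hneg₁ r hlt.le)
    · by_contra hlt; push Not at hlt
      exact lt_asymm (h1 hr) (hpos₂ (r.1 + 2 * π, r.2) (by simp only; linarith [Real.pi_pos]))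
  · intro hq
    by_contra hq'
    have hqK : q ∉ range el := fun h ↦ (ne_of_lt hq) ((hg0₁ q).2 h)
    have hqB : 0 < g₂ (map n (q.1 + 2 * π, q.2)) :=
      (lt_or_gt_of_ne (fun h ↦ hqK ((hg0₂ q).1 h))).resolve_left hq'
    have h1 : connectedComponentIn (range el)ᶜ q ⊆ {r | g₁ (map n r) < 0} :=
      hcomp hoA hoB hd₁ hcov₁ hq hqK
    have h2 : connectedComponentIn (range el)ᶜ q ⊆ {r | 0 < g₂ (map n (r.1 + 2 * π, r.2))} :=
      hcomp hoB' hoA' hd₂.symm (union_comm _ _ ▸ hcov₂) hqB hqK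
    refine not_bdd_connectedComponentIn_compl_range_lift hn he hconn hel.contMDiff.continuous hlift
      hqK (a := -T₂ - 2 * π) (b := T₁) fun r hr ↦ ⟨⟨?_, ?_⟩, mem_univ _⟩
    · by_contra hlt; push Not at hlt
      exact lt_asymm (h2 hr) (hneg₂ (r.1 + 2 * π, r.2) (by simp only; linarith))
    · by_contra hlt; push Not at hlt
      exact lt_asymm (h1 hr) (hpos₁ r hlt.le)

/-- The zero sets correspond under `τ`: `g₂ (ι (τ q)) = 0 ↔ g₁ (ι q) = 0` (both mean
`q ∈ ẽ(Sⁿ)`). [folklore] -/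
theorem eq_zero_translate_iff_eq_zero
    {el : 𝕊 n → ℝ × 𝕊 n}
    {g₁ : 𝕊 (n + 1) → ℝ} (hg₁ : IsSidePackage (range (map n ∘ el)) g₁)
    {g₂ : 𝕊 (n + 1) → ℝ}
    (hg₂ : IsSidePackage (range (map n ∘ (fun q : ℝ × 𝕊 n ↦ ((q.1 + 2 * π, q.2) : ℝ × 𝕊 n)) ∘ el))
      g₂) (q : ℝ × 𝕊 n) :
    g₂ (map n (q.1 + 2 * π, q.2)) = 0 ↔ g₁ (map n q) = 0 := by
  have hg0₁ : g₁ (map n q) = 0 ↔ q ∈ range el := by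
    have : g₁ (map n q) = 0 ↔ map n q ∈ range (map n ∘ el) := by rw [← hg₁.preimage_zero]; rfl
    rw [this, range_comp]
    exact (injective_map n).mem_set_image
  have hg0₂ : g₂ (map n (q.1 + 2 * π, q.2)) = 0 ↔ q ∈ range el := by
    have : g₂ (map n (q.1 + 2 * π, q.2)) = 0 ↔ map n (q.1 + 2 * π, q.2) ∈
        range (map n ∘ (fun q : ℝ × 𝕊 n ↦ ((q.1 + 2 * π, q.2) : ℝ × 𝕊 n)) ∘ el) := by
      rw [← hg₂.preimage_zero]; rfl
    rw [this]
    constructor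
    · rintro ⟨y, hy⟩
      simp only [comp_apply] at hy
      obtain ⟨h1a, h1b⟩ := Prod.mk.inj (injective_map n hy)
      exact ⟨y, Prod.ext (by linarith) h1b⟩
    · rintro ⟨y, rfl⟩
      exact ⟨y, rfl⟩
  rw [hg0₁, hg0₂]

/-- Every deck orbit reaches the lower side: for every `p` there is `k ∈ ℤ` with
`g₁ (ι (t + 2πk, y)) < 0`. [folklore] -/
theorem exists_int_neg {g₁ : 𝕊 (n + 1) → ℝ} (hgc : Continuous g₁) (hS : g₁ (southPole n) < 0)
    (hN : 0 < g₁ (northPole n)) (p : ℝ × 𝕊 n) :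
    ∃ k : ℤ, g₁ (map n (p.1 + k * (2 * π), p.2)) < 0 := by
  obtain ⟨T, hT, -, hneg⟩ := exists_ends_of_sign_poles hgc hN hS
  refine ⟨-(⌈(p.1 + T) / (2 * π)⌉ + 1), hneg _ ?_⟩
  have hπ : (0 : ℝ) < 2 * π := by positivity
  have h1 : (p.1 + T) / (2 * π) ≤ ⌈(p.1 + T) / (2 * π)⌉ := Int.le_ceil _
  rw [div_le_iff₀ hπ] at h1
  simp only
  push_cast
  nlinarith

/-- Every deck orbit reaches the upper side: for every `p` there is `k ∈ ℤ` with
`0 ≤ g₁ (ι (t + 2πk, y))`. [folklore] -/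
theorem exists_int_nonneg {g₁ : 𝕊 (n + 1) → ℝ} (hgc : Continuous g₁) (hS : g₁ (southPole n) < 0)
    (hN : 0 < g₁ (northPole n)) (p : ℝ × 𝕊 n) :
    ∃ k : ℤ, 0 ≤ g₁ (map n (p.1 + k * (2 * π), p.2)) := by
  obtain ⟨T, hT, hpos, -⟩ := exists_ends_of_sign_poles hgc hN hS
  refine ⟨⌈(T - p.1) / (2 * π)⌉, (hpos _ ?_).le⟩
  have hπ : (0 : ℝ) < 2 * π := by positivity
  have h1 : (T - p.1) / (2 * π) ≤ ⌈(T - p.1) / (2 * π)⌉ := Int.le_ceil _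
  rw [div_le_iff₀ hπ] at h1
  simp only
  linarith


end BudneyGabai2019_thm_3_13

end Literature.Topology.FourManifolds

end
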